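import Mathlib
import Summits.ResolutionOfSingularities.ResolutionOfSingularities.Theorems.FrobeniusClosingSteerLowOrderSecond

/-!
# Crux `Steer` (stmt-ResolutionOfSingularities-16345), σ-residual LOW half at `p = 2`:
# `lowOrder_step_two`, the RANK-FOUR case at a point step

OURS (campaign `res-hironaka`, rung L ★L-G4, slot W4.1, chain W4.1; seat `res-D-pv-028` g6, res-L0-w41-plan-1 RULING 15
(15b); replaces the role of no printed item; NOT a statement of the manuscript under review [claim: Hironaka2017,
status: under-review]; AI review is weaker than expert review). Setting of `…SteerLowOrderFirst`.

* `false_of_two_pairs` — if the coefficient matrix has TWO off-diagonal unit entries on disjoint pairs covering all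
  indices (the rank-four normal form at a point step) and all other off-diagonal entries in `𝔪_R`, then no cleaning of
  the transformed radicand lies in `𝔫²`: the kernel equations of the first-order engine force `v̄ = 0`, contradicting
  `Σ c̄_j v̄_j = 1` (= res-L0-w41-stub-3's rank-four exit B7, first-order form). [folklore]
-/

-- The namespace mirrors the chain's helper layout (`…Theorems.SwitchingDichotomy.<Piece>`) on purpose.
set_option linter.dupNamespace false

noncomputable section

namespace Summit.ResolutionOfSingularities.ResolutionOfSingularities.Theorems.SwitchingDichotomy.LowOrderRankFour

open IsLocalRing Module Literature.AlgebraicGeometry.Resolution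
open Summit.ResolutionOfSingularities.ResolutionOfSingularities.Theorems.SwitchingDichotomy
open Summit.ResolutionOfSingularities.ResolutionOfSingularities.Theorems.SwitchingDichotomy.LowOrderFirst
open Summit.ResolutionOfSingularities.ResolutionOfSingularities.Theorems.SwitchingDichotomy.LowOrderSecond

universe u

variable {K : Type u} [Field K] [CharP K 2]
variable {R R₁ : Subring K} [IsLocalRing R] [IsRegularLocalRing R₁] (hRR₁ : R ≤ R₁)
  (hloc : ∀ m : R, m ∈ maximalIdeal R → residue R₁ (Subring.inclusion hRR₁ m) = 0)
  (hperf : ∀ a : R, ∃ b : R, a - b ^ 2 ∈ maximalIdeal R)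
  {h e : ℕ} (u : Fin h → R) (w : Fin e → R)
  (huw : Ideal.span (Set.range u ∪ Set.range w) = maximalIdeal R)
  (x' : R₁) (hx'm : x' ∈ maximalIdeal R₁) (hx'0 : x' ≠ 0)
  (v : Fin h → R₁) (hv : ∀ j, Subring.inclusion hRR₁ (u j) = x' * v j)
  (c : Fin h → R) (hc : Subring.inclusion hRR₁ (∑ j, c j * u j) = x')
  (δ : R₁ → CotangentSpace R₁)
  (hδadd : ∀ a b : R₁, δ (a + b) = δ a + δ b)
  (hδmul : ∀ a b : R₁, δ (a * b) = residue R₁ a • δ b + residue R₁ b • δ a)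
  (hδmem : ∀ (m : R₁) (hm : m ∈ maximalIdeal R₁), δ m = (maximalIdeal R₁).toCotangent ⟨m, hm⟩)
  (hδsq : ∀ b : R₁, δ (b ^ 2) = 0)
  (hdim₁ : finrank (ResidueField R₁) (CotangentSpace R₁) = 4) (hhe : h + e = 4)
  (hspan : Submodule.span (ResidueField R₁)
    (Set.range (fun a : R => δ ⟨a, hRR₁ a.2⟩) ∪ Set.range (fun j => δ (v j))) = ⊤)
  (G : Fin h → Fin h → R) (θ G' f₁ : R₁)
  (hθ : θ ∈ Ideal.span (Set.range (Fin.cons x' (fun l => Subring.inclusion hRR₁ (w l)) : Fin (e + 1) → R₁)))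
  (hf₁ : f₁ = ∑ j, ∑ k, Subring.inclusion hRR₁ (G j k) * v j * v k + θ + G' ^ 2)

/-! ## RANK FOUR (point step): two disjoint unit pairs -/

include hloc hperf huw hx'm hx'0 hv hc hδadd hδmul hδmem hδsq hdim₁ hhe hspan hθ hf₁ in
/-- **RANK FOUR — the kernel vector vanishes.** If the coefficient matrix has TWO off-diagonal unit entries
`G j₁ j₂`, `G j₃ j₄` on disjoint pairs covering all indices (the rank-four normal form at a point step, `h = 4`) and all
other off-diagonal entries in `𝔪_R`, then no cleaning of the transformed radicand lies in `𝔫²`: the kernel equations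
force `v̄ = 0`, contradicting `Σ c̄_j v̄_j = 1`. (= res-L0-w41-stub-3's rank-four exit, first-order form.) [folklore] -/
theorem false_of_two_pairs (j₁ j₂ j₃ j₄ : Fin h) (h12 : j₁ ≠ j₂) (h13 : j₁ ≠ j₃) (h14 : j₁ ≠ j₄)
    (h23 : j₂ ≠ j₃) (h24 : j₂ ≠ j₄) (h34 : j₃ ≠ j₄) (hcover : ∀ j, j = j₁ ∨ j = j₂ ∨ j = j₃ ∨ j = j₄)
    (hunit12 : IsUnit (G j₁ j₂)) (hunit34 : IsUnit (G j₃ j₄))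
    (hoff : ∀ j k, j ≠ k → ¬ (j = j₁ ∧ k = j₂) → ¬ (j = j₃ ∧ k = j₄) → G j k ∈ maximalIdeal R)
    (hhigh : ∃ g' : R₁, f₁ - g' ^ 2 ∈ maximalIdeal R₁ ^ 2) : False := by
  classical
  have hker := kernel_of_high hRR₁ hloc hperf u w huw x' hx'm hx'0 v hv c hc δ hδadd hδmul hδmem hδsq hdim₁ hhe
    hspan G θ G' f₁ hθ hf₁ hhigh
  -- generic step: a column with exactly one residually non-zero symmetric entry kills that coordinate of `v̄`
  have step : ∀ a b : Fin h, a ≠ b → residue R₁ (Subring.inclusion hRR₁ (G a b + G b a)) ≠ 0 →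
      (∀ j, j ≠ b → j ≠ a → G j b ∈ maximalIdeal R ∧ G b j ∈ maximalIdeal R) → residue R₁ (v a) = 0 := by
    intro a b hab hne hoffk
    have hk := kernel_single hRR₁ hloc v G a b hab hoffk (hker b)
    exact (mul_eq_zero.mp hk).resolve_left hne
  have hres := fun {a : R} (ha : a ∈ maximalIdeal R) => residue_inclusion_eq_zero hRR₁ hloc ha
  have h21 : G j₂ j₁ ∈ maximalIdeal R := hoff j₂ j₁ h12.symm (fun hh => h12 hh.1.symm) (fun hh => h23 hh.1)
  have h43 : G j₄ j₃ ∈ maximalIdeal R := hoff j₄ j₃ h34.symm (fun hh => h14 hh.1.symm) (fun hh => h34 hh.1.symm)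
  have hu12 : residue R₁ (Subring.inclusion hRR₁ (G j₁ j₂)) ≠ 0 :=
    ((hunit12.map (Subring.inclusion hRR₁)).map (residue R₁)).ne_zero
  have hu34 : residue R₁ (Subring.inclusion hRR₁ (G j₃ j₄)) ≠ 0 :=
    ((hunit34.map (Subring.inclusion hRR₁)).map (residue R₁)).ne_zero
  have hv1 : residue R₁ (v j₁) = 0 := by
    refine step j₁ j₂ h12 (by rw [map_add, map_add, hres h21, add_zero]; exact hu12) fun j hj2 hj1 => ⟨?_, ?_⟩
    · exact hoff j j₂ hj2 (fun hh => hj1 hh.1) (fun hh => h24 hh.2)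
    · exact hoff j₂ j (Ne.symm hj2) (fun hh => h12 hh.1.symm) (fun hh => h23 hh.1)
  have hv2 : residue R₁ (v j₂) = 0 := by
    refine step j₂ j₁ h12.symm (by rw [map_add, map_add, hres h21, zero_add]; exact hu12) fun j hj1 hj2 => ⟨?_, ?_⟩
    · exact hoff j j₁ hj1 (fun hh => hj1 hh.1) (fun hh => h14 hh.2)
    · exact hoff j₁ j (Ne.symm hj1) (fun hh => hj2 hh.2) (fun hh => h13 hh.1)
  have hv3 : residue R₁ (v j₃) = 0 := by
    refine step j₃ j₄ h34 (by rw [map_add, map_add, hres h43, add_zero]; exact hu34) fun j hj4 hj3 => ⟨?_, ?_⟩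
    · exact hoff j j₄ hj4 (fun hh => h24 hh.2.symm) (fun hh => hj3 hh.1)
    · exact hoff j₄ j (Ne.symm hj4) (fun hh => h14 hh.1.symm) (fun hh => h34 hh.1.symm)
  have hv4 : residue R₁ (v j₄) = 0 := by
    refine step j₄ j₃ h34.symm (by rw [map_add, map_add, hres h43, zero_add]; exact hu34) fun j hj3 hj4 => ⟨?_, ?_⟩
    · exact hoff j j₃ hj3 (fun hh => h23 hh.2.symm) (fun hh => hj3 hh.1)
    · exact hoff j₃ j (Ne.symm hj3) (fun hh => h13 hh.1.symm) (fun hh => hj4 hh.2)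
  have hall : ∀ j, residue R₁ (v j) = 0 := by
    intro j
    rcases hcover j with rfl | rfl | rfl | rfl
    · exact hv1
    · exact hv2
    · exact hv3
    · exact hv4
  have h1 := sum_residue_c_mul_v hRR₁ u x' hx'0 v hv c hc
  rw [Finset.sum_eq_zero fun j _ => by rw [hall j, mul_zero]] at h1
  exact zero_ne_one h1


end Summit.ResolutionOfSingularities.ResolutionOfSingularities.Theorems.SwitchingDichotomy.LowOrderRankFour

end
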